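import Summits.BirchSwinnertonDyer.BirchSwinnertonDyer.Theorems.BiquadraticEisensteinDescentHeegnerTwistCouplingInSupplySymbolicMonskyEvenKernelParity
import Summits.BirchSwinnertonDyer.BirchSwinnertonDyer.Theorems.BiquadraticEisensteinDescentHeegnerTwistCouplingInSupplySymbolicMonskyDesignExists
import HarnessLib

set_option linter.dupNamespace false -- `Summit.BirchSwinnertonDyer.BirchSwinnertonDyer.Theorems.…` (summit = sub)
set_option autoImplicit false

/-!
# Crux `HeegnerTwistCouplingInSupply` (stmt-BirchSwinnertonDyer-21381) — KERNEL PARITY for the ODD bases `E_{P₀⋯P_k}`: the virtual kernel of a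
# root-number-`−1` odd base has ODD dimension; THEOREM A (odd) with the dimension hypothesis discharged

Route `BiquadraticEisensteinDescent` (cell `pub/bsd-wall`, width seat `bsd-wall-cm-bed-w3` g24; `--supports` 21381, helper). Twin of
`…SymbolicMonskyEvenKernelParity` (p751399) for the ODD side: memos PATTERN-FREE-MECHANISM-w3g20 / THEOREM-A-w3g22 / THEOREM-B-w3g23 §3 used
`s := dim 𝒦` odd (numerics; §3 of THEOREM-B-w3g23 explained it for μ odd via the symmetric matrix `[[D_m, L],[Lᵀ, D_d]]` with characteristic
vector `𝟙`). Here it is PROVED for ALL root-number-`−1` odd bases, both classes `n₀ ≡ 7 (8)` (μ odd, |d| even) and `n₀ ≡ 5 (8)` (μ even, |d| odd)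
at once: with `c := 1 + μ ∈ 𝔽₂` the virtual kernel `𝒦 = {(x,y) : (L + D_m)x + D_d y = 0, D_m x + L y = 0}` (reviewed `SymbData.virtualKernel`)
is the kernel of the SYMMETRIC matrix `S̃ = [[D_m, L],[Lᵀ, D_d + c·mmᵀ]]` — because the column sums of the Laplacian are `c·m`
(`sum_lBlock_eq`, quadratic reciprocity), so `⟨m,x⟩ = c⟨m,y⟩` on `𝒦` — and `diag S̃ = (m; d + c·m) = S̃𝟙`, `𝟙ᵀS̃𝟙 = μ + |d| = 1`; the general
parity lemma `odd_finrank_ker_of_isSymm_of_diag` (p751399; Godsil–Royle Thm 8.10.1 via the tree's `rank_even_of_isSymm_of_diag_eq_zero`) applies.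
* ★★ `odd_finrank_virtualKernel` — `Σ_b ([P_b ≡ 3 (4)] + [(2/P_b) = −1]) = 1 ⇒ Odd (finrank 𝒦)`;
* ★ `finrank_augKernel_eq` — `(δ,1) ∉ 𝒦 ⇒ finrank 𝒦⁺(δ) = finrank 𝒦 + 1`;
* ★★ `exists_patternFree_design_of_odd` — THEOREM A (`exists_patternFree_design`, p742384) at `τ := (finrank 𝒦 + 1)/2` with `hdim` DISCHARGED.

HONEST FRAMING: RUNG-LEVEL corner layer (odd congruent `j = 1728` families `E_{n₀}`); linear algebra over `𝔽₂` attached to Monsky matrices; the crux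
as stated (C⁺), its registered stubs and BSD are NOT touched; nothing is closed. THEOREMS ONLY (no `def`, no instance, no notation).
References: [HeathBrown1994] D. R. Heath-Brown, Invent. Math. 118 (1994) 331–370, appendix (Monsky), typescript pp. 39–41;
[GodsilRoyle2001] C. Godsil, G. Royle, Algebraic Graph Theory, GTM 207, Thm 8.10.1.
-/

namespace Summit.BirchSwinnertonDyer.BirchSwinnertonDyer.Theorems.SymbolicMonsky

section OddKernelParity

open Module Matrix

variable {k : ℕ} (base : SymbData (k + 1))

/-- Row of the Laplacian block `L`: `(L y)_i = Σ_j [(P_j/P_i) = −1](y_j + y_i)`. -/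
private theorem lBlock_mulVec (y : Fin (k + 1) → ZMod 2) (i : Fin (k + 1)) :
    ((Matrix.of fun i j : Fin (k + 1) => bz (base.neg i j) + if i = j then (∑ l, bz (base.neg i l)) else 0) *ᵥ y) i =
      ∑ j, bz (base.neg i j) * (y j + y i) := by
  simp only [mulVec, dotProduct, Matrix.of_apply]
  have e1 : (∑ j, (bz (base.neg i j) + if i = j then (∑ l, bz (base.neg i l)) else 0) * y j) =
      (∑ j, bz (base.neg i j) * y j) + ∑ j, (if i = j then (∑ l, bz (base.neg i l)) * y j else 0) := by
    rw [← Finset.sum_add_distrib]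
    refine Finset.sum_congr rfl fun j _ => ?_
    split_ifs <;> ring
  have e2 : (∑ j, bz (base.neg i j) * (y j + y i)) = (∑ j, bz (base.neg i j) * y j) + (∑ l, bz (base.neg i l)) * y i := by
    rw [Finset.sum_mul, ← Finset.sum_add_distrib]
    exact Finset.sum_congr rfl fun j _ => by ring
  rw [e1, Finset.sum_ite_eq, e2]
  simp only [Finset.mem_univ, if_true]

/-- Row of the transposed Laplacian block `Lᵀ` (quadratic reciprocity): `(Lᵀ x)_i = Σ_j [(P_j/P_i) = −1](x_j + x_i) + m_i ⟨m,x⟩ + m_i x_i`. -/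
private theorem ltBlock_mulVec (x : Fin (k + 1) → ZMod 2) (i : Fin (k + 1)) :
    ((Matrix.of fun i j : Fin (k + 1) => bz (base.neg i j) + bz (negNegOne (base.cls i)) * bz (negNegOne (base.cls j)) +
        if i = j then (∑ l, bz (base.neg i l)) + bz (negNegOne (base.cls i)) else 0) *ᵥ x) i =
      (∑ j, bz (base.neg i j) * (x j + x i)) + bz (negNegOne (base.cls i)) * (∑ j, bz (negNegOne (base.cls j)) * x j) +
        bz (negNegOne (base.cls i)) * x i := by
  simp only [mulVec, dotProduct, Matrix.of_apply]
  have e1 : (∑ j, (bz (base.neg i j) + bz (negNegOne (base.cls i)) * bz (negNegOne (base.cls j)) +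
      if i = j then (∑ l, bz (base.neg i l)) + bz (negNegOne (base.cls i)) else 0) * x j) =
      (∑ j, bz (base.neg i j) * x j) + bz (negNegOne (base.cls i)) * (∑ j, bz (negNegOne (base.cls j)) * x j) +
        ∑ j, (if i = j then ((∑ l, bz (base.neg i l)) + bz (negNegOne (base.cls i))) * x j else 0) := by
    rw [Finset.mul_sum, ← Finset.sum_add_distrib, ← Finset.sum_add_distrib]
    refine Finset.sum_congr rfl fun j _ => ?_
    split_ifs <;> ring
  have e2 : (∑ j, bz (base.neg i j) * (x j + x i)) = (∑ j, bz (base.neg i j) * x j) + (∑ l, bz (base.neg i l)) * x i := by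
    rw [Finset.sum_mul, ← Finset.sum_add_distrib]
    exact Finset.sum_congr rfl fun j _ => by ring
  rw [e1, Finset.sum_ite_eq, e2]
  simp only [Finset.mem_univ, if_true]
  ring

/-- `Lᵀ` is the transpose of `L` (quadratic reciprocity `bz_neg_swap`). -/
private theorem lBlock_transpose :
    (Matrix.of fun i j : Fin (k + 1) => bz (base.neg i j) + if i = j then (∑ l, bz (base.neg i l)) else 0)ᵀ =
      (Matrix.of fun i j : Fin (k + 1) => bz (base.neg i j) + bz (negNegOne (base.cls i)) * bz (negNegOne (base.cls j)) +
        if i = j then (∑ l, bz (base.neg i l)) + bz (negNegOne (base.cls i)) else 0) := by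
  have h2 : ∀ x : ZMod 2, x + x = 0 := by decide
  have hsq : ∀ x : ZMod 2, x * x = x := by decide
  ext i j
  simp only [transpose_apply, Matrix.of_apply]
  by_cases hij : i = j
  · subst hij
    simp only [if_true]
    linear_combination (hsq (bz (negNegOne (base.cls i)))).symm - h2 (bz (negNegOne (base.cls i)))
  · have hji : j ≠ i := fun h => hij h.symm
    rw [if_neg hji, if_neg hij, base.bz_neg_swap hij, bz_and_mul, Bool.and_comm]

/-- The column sums of the Laplacian: `Σ_i Σ_j [(P_j/P_i) = −1](y_j + y_i) = (1 + μ)·⟨m,y⟩` (`μ = Σ_b [P_b ≡ 3 (4)]`; quadratic reciprocity). -/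
private theorem sum_lBlock_eq (y : Fin (k + 1) → ZMod 2) :
    (∑ i, ∑ j, bz (base.neg i j) * (y j + y i)) =
      (1 + ∑ b, bz (negNegOne (base.cls b))) * ∑ j, bz (negNegOne (base.cls j)) * y j := by
  have h2 : ∀ x : ZMod 2, x + x = 0 := by decide
  have hsq : ∀ x : ZMod 2, x * x = x := by decide
  -- split `Σ_i Σ_j n_ij y_j + Σ_i Σ_j n_ij y_i`, swap the first
  have e1 : (∑ i, ∑ j, bz (base.neg i j) * (y j + y i)) = ∑ i, ∑ j, (bz (base.neg j i) + bz (base.neg i j)) * y i := by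
    have : (∑ i, ∑ j, bz (base.neg i j) * (y j + y i)) = (∑ i, ∑ j, bz (base.neg i j) * y j) + ∑ i, ∑ j, bz (base.neg i j) * y i := by
      rw [← Finset.sum_add_distrib]
      refine Finset.sum_congr rfl fun i _ => ?_
      rw [← Finset.sum_add_distrib]
      exact Finset.sum_congr rfl fun j _ => by ring
    rw [this, Finset.sum_comm]
    rw [← Finset.sum_add_distrib]
    refine Finset.sum_congr rfl fun i _ => ?_
    rw [← Finset.sum_add_distrib]
    exact Finset.sum_congr rfl fun j _ => by ring
  -- pointwise reciprocity: `(n_ji + n_ij) y_i = [j ≠ i] m_i m_j y_i`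
  have e2 : ∀ i, (∑ j, (bz (base.neg j i) + bz (base.neg i j)) * y i) =
      (∑ j, bz (negNegOne (base.cls i)) * bz (negNegOne (base.cls j)) * y i) + bz (negNegOne (base.cls i)) * y i := by
    intro i
    have hpt : ∀ j, (bz (base.neg j i) + bz (base.neg i j)) * y i =
        bz (negNegOne (base.cls i)) * bz (negNegOne (base.cls j)) * y i + (if j = i then bz (negNegOne (base.cls i)) * y i else 0) := by
      intro j
      by_cases hji : j = i
      · subst hji
        rw [if_pos rfl]
        linear_combination (h2 (bz (base.neg j j))) * y j - (hsq (bz (negNegOne (base.cls j)))) * y j -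
          h2 (bz (negNegOne (base.cls j)) * y j)
      · have hij : i ≠ j := fun h => hji h.symm
        rw [if_neg hji, base.bz_neg_swap hij, bz_and_mul]
        linear_combination (h2 (bz (base.neg i j))) * y i
    rw [Finset.sum_congr rfl fun j _ => hpt j, Finset.sum_add_distrib, Finset.sum_ite_eq' Finset.univ i]
    simp only [Finset.mem_univ, if_true]
  rw [e1, Finset.sum_congr rfl fun i _ => e2 i, Finset.sum_add_distrib, add_mul, one_mul, Finset.mul_sum]
  have e3 : ∀ i, (∑ j, bz (negNegOne (base.cls i)) * bz (negNegOne (base.cls j)) * y i) =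
      (∑ b, bz (negNegOne (base.cls b))) * (bz (negNegOne (base.cls i)) * y i) := by
    intro i
    rw [Finset.sum_mul]
    exact Finset.sum_congr rfl fun j _ => by ring
  rw [Finset.sum_congr rfl fun i _ => e3 i, add_comm]

/-- ★★ **KERNEL PARITY (odd bases).** For every base datum of root number `−1` — `Σ_b ([P_b ≡ 3 (4)] + [(2/P_b) = −1]) = 1` in `𝔽₂`, i.e.
`n₀ = P₀⋯P_k ≡ 5, 7 (mod 8)` — the virtual kernel `𝒦` (`SymbData.virtualKernel`) has ODD dimension; hence `τ₀ := (dim 𝒦 + 1)/2` is an integer and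
the augmented kernel `𝒦⁺ = 𝒦 ⊕ ⟨(δ,1)⟩` of a legitimate design has even dimension (hypothesis `hdim` of THEOREM A `exists_patternFree_design`).
Proof: with `c := 1 + μ`, `𝒦 = ker S̃` for the SYMMETRIC matrix `S̃ = [[D_m, L],[Lᵀ, D_d + c·mmᵀ]]` (on `𝒦` one has `⟨m,x⟩ = c⟨m,y⟩` because the
column sums of `L` are `c·m`), `diag S̃ = (m; d + c·m) = S̃ 𝟙` and `𝟙ᵀ S̃ 𝟙 = μ + |d| + cμ = μ + |d| = 1`; apply `odd_finrank_ker_of_isSymm_of_diag`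
(Godsil–Royle 8.10.1). [cite: HeathBrown1994SelmerCongruentII, Appendix (Monsky), typescript pp. 39–41] -/
theorem odd_finrank_virtualKernel (hroot : (∑ b, (bz (negNegOne (base.cls b)) + bz (negTwo (base.cls b)))) = 1) :
    Odd (finrank (ZMod 2) ↥base.virtualKernel) := by
  have h2 : ∀ x : ZMod 2, x + x = 0 := by decide
  have hsq : ∀ x : ZMod 2, x * x = x := by decide
  set μ : ZMod 2 := ∑ b, bz (negNegOne (base.cls b)) with hμ
  set c : ZMod 2 := 1 + μ with hc
  set dv : Fin (k + 1) → ZMod 2 := fun i => bz (negTwo (base.cls i)) with hdv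
  set mv : Fin (k + 1) → ZMod 2 := fun i => bz (negNegOne (base.cls i)) with hmv
  set Lm : Matrix (Fin (k + 1)) (Fin (k + 1)) (ZMod 2) := Matrix.of fun i j : Fin (k + 1) => bz (base.neg i j) +
      if i = j then (∑ l, bz (base.neg i l)) else 0 with hLm
  set Lt : Matrix (Fin (k + 1)) (Fin (k + 1)) (ZMod 2) := Matrix.of fun i j : Fin (k + 1) => bz (base.neg i j) +
      bz (negNegOne (base.cls i)) * bz (negNegOne (base.cls j)) +
      if i = j then (∑ l, bz (base.neg i l)) + bz (negNegOne (base.cls i)) else 0 with hLt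
  have hLT : Lmᵀ = Lt := lBlock_transpose base
  set Dc : Matrix (Fin (k + 1)) (Fin (k + 1)) (ZMod 2) := diagonal dv + c • vecMulVec mv mv with hDc
  have hDcsymm : Dc.IsSymm := by
    rw [hDc]
    exact (isSymm_diagonal _).add (Matrix.IsSymm.smul (show (vecMulVec mv mv).IsSymm from transpose_vecMulVec mv mv) c)
  set S : Matrix (Fin (k + 1) ⊕ Fin (k + 1)) (Fin (k + 1) ⊕ Fin (k + 1)) (ZMod 2) :=
    Matrix.fromBlocks (diagonal mv) Lm Lt Dc with hS
  have hSsymm : S.IsSymm := Matrix.IsSymm.fromBlocks (isSymm_diagonal _) hLT hDcsymm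
  set e₀ : Fin (k + 1) ⊕ Fin (k + 1) → ZMod 2 := Sum.elim (1 : Fin (k + 1) → ZMod 2) (1 : Fin (k + 1) → ZMod 2) with he₀
  have hSmul : ∀ x y : Fin (k + 1) → ZMod 2, S *ᵥ Sum.elim x y = Sum.elim (diagonal mv *ᵥ x + Lm *ᵥ y) (Lt *ᵥ x + Dc *ᵥ y) := by
    intro x y
    rw [hS, fromBlocks_mulVec]
    rfl
  have hDcmul : ∀ (y : Fin (k + 1) → ZMod 2) i, (Dc *ᵥ y) i = dv i * y i + c * (mv i * ∑ j, mv j * y j) := by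
    intro y i
    rw [hDc, add_mulVec, smul_mulVec, vecMulVec_mulVec, op_smul_eq_smul]
    simp only [Pi.add_apply, Pi.smul_apply, mulVec_diagonal, smul_eq_mul, dotProduct]
    ring
  have hL1 : ∀ i, (Lm *ᵥ (1 : Fin (k + 1) → ZMod 2)) i = 0 := by
    intro i
    rw [lBlock_mulVec]
    simp [h2]
  have hLt1 : ∀ i, (Lt *ᵥ (1 : Fin (k + 1) → ZMod 2)) i = c * mv i := by
    intro i
    rw [ltBlock_mulVec]
    simp only [Pi.one_apply, h2, mul_zero, Finset.sum_const_zero, zero_add, mul_one, hc, hmv]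
    ring
  have hdiag : ∀ i, S i i = (S *ᵥ e₀) i := by
    have he : e₀ = Sum.elim (1 : Fin (k + 1) → ZMod 2) (1 : Fin (k + 1) → ZMod 2) := rfl
    intro i
    rw [he, hSmul]
    rcases i with a | a
    · simp only [Sum.elim_inl, Pi.add_apply, hL1, add_zero, mulVec_diagonal, Pi.one_apply, mul_one]
      rw [hS, fromBlocks_apply₁₁, diagonal_apply_eq]
    · simp only [Sum.elim_inr, Pi.add_apply, hLt1, hDcmul, Pi.one_apply, mul_one]
      rw [hS, fromBlocks_apply₂₂, hDc, Matrix.add_apply, diagonal_apply_eq, Matrix.smul_apply, vecMulVec_apply, smul_eq_mul, hsq]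
      have : (∑ j : Fin (k + 1), mv j) = μ := by rw [hμ]
      rw [this, hc]
      linear_combination (- hsq μ - h2 μ) * mv a
  have hodd : e₀ ⬝ᵥ (S *ᵥ e₀) = 1 := by
    have he : e₀ = Sum.elim (1 : Fin (k + 1) → ZMod 2) (1 : Fin (k + 1) → ZMod 2) := rfl
    rw [he, hSmul, dotProduct, Fintype.sum_sum_type]
    simp only [Sum.elim_inl, Sum.elim_inr, Pi.one_apply, one_mul, Pi.add_apply, hL1, add_zero, mulVec_diagonal, mul_one, hLt1, hDcmul]
    have hm : (∑ j : Fin (k + 1), mv j) = μ := by rw [hμ]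
    rw [hm]
    have e : (∑ x : Fin (k + 1), (c * mv x + (dv x + c * (mv x * μ)))) = c * μ + (∑ x, dv x) + c * μ * μ := by
      rw [Finset.sum_add_distrib, Finset.sum_add_distrib, ← Finset.mul_sum, hm, ← Finset.mul_sum, ← Finset.sum_mul, hm]
      ring
    rw [e]
    have hd : (∑ x : Fin (k + 1), dv x) = 1 + μ := by
      have := hroot
      rw [Finset.sum_add_distrib] at this
      rw [hdv]
      linear_combination this - h2 μ
    rw [hd, hc]
    linear_combination (μ + 3) * hsq μ + 3 * h2 μ
  have heven : Even (Fintype.card (Fin (k + 1) ⊕ Fin (k + 1))) := ⟨k + 1, by simp⟩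
  have hpar := odd_finrank_ker_of_isSymm_of_diag S hSsymm e₀ hdiag hodd heven
  -- `(x, y) ↦ (x; y)` identifies the virtual kernel with `ker S`
  let Ψ : ((Fin (k + 1) → ZMod 2) × (Fin (k + 1) → ZMod 2)) →ₗ[ZMod 2] (Fin (k + 1) ⊕ Fin (k + 1) → ZMod 2) :=
    { toFun := fun p => Sum.elim p.1 p.2
      map_add' := by
        intro p q
        funext i
        rcases i with a | a <;> simp
      map_smul' := by
        intro c p
        funext i
        rcases i with a | a <;> simp }
  have hΨ : ∀ p, Ψ p = Sum.elim p.1 p.2 := fun p => rfl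
  have hΨinj : Function.Injective Ψ := by
    intro p q hpq
    rw [hΨ, hΨ] at hpq
    refine Prod.ext ?_ ?_
    · funext a; exact congrFun hpq (Sum.inl a)
    · funext a; exact congrFun hpq (Sum.inr a)
  -- the column-sum relation `⟨m,x⟩ = c⟨m,y⟩` forced by the second virtual equation
  have hrel : ∀ x y : Fin (k + 1) → ZMod 2,
      (∀ i, bz (negNegOne (base.cls i)) * x i + ∑ j, bz (base.neg i j) * (y j + y i) = 0) →
        (∑ j, bz (negNegOne (base.cls j)) * x j) + c * ∑ j, bz (negNegOne (base.cls j)) * y j = 0 := by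
    intro x y h
    have hs : (∑ i, (bz (negNegOne (base.cls i)) * x i + ∑ j, bz (base.neg i j) * (y j + y i))) = 0 :=
      Finset.sum_eq_zero fun i _ => h i
    rw [Finset.sum_add_distrib, sum_lBlock_eq, ← hμ, ← hc] at hs
    exact hs
  have hmem : ∀ p : (Fin (k + 1) → ZMod 2) × (Fin (k + 1) → ZMod 2), p ∈ base.virtualKernel ↔ S *ᵥ Ψ p = 0 := by
    intro p
    rw [mem_virtualKernel_iff, hΨ, hSmul]
    have hrow1 : ∀ i, (diagonal mv *ᵥ p.1 + Lm *ᵥ p.2) i = bz (negNegOne (base.cls i)) * p.1 i + ∑ j, bz (base.neg i j) * (p.2 j + p.2 i) := by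
      intro i
      rw [Pi.add_apply, mulVec_diagonal, lBlock_mulVec]
    have hrow2 : ∀ i, (Lt *ᵥ p.1 + Dc *ᵥ p.2) i =
        (∑ j, bz (base.neg i j) * (p.1 j + p.1 i)) + bz (negNegOne (base.cls i)) * (∑ j, bz (negNegOne (base.cls j)) * p.1 j) +
          bz (negNegOne (base.cls i)) * p.1 i + (bz (negTwo (base.cls i)) * p.2 i +
            c * (bz (negNegOne (base.cls i)) * ∑ j, bz (negNegOne (base.cls j)) * p.2 j)) := by
      intro i
      rw [Pi.add_apply, ltBlock_mulVec, hDcmul]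
    constructor
    · rintro ⟨hE1, hE2⟩
      have hr := hrel p.1 p.2 hE2
      funext i
      rcases i with a | a
      · rw [Sum.elim_inl, hrow1, Pi.zero_apply]
        exact hE2 a
      · rw [Sum.elim_inr, hrow2, Pi.zero_apply]
        have e1 := hE1 a
        linear_combination e1 + bz (negNegOne (base.cls a)) * hr
    · intro h
      have r1 : ∀ a, (diagonal mv *ᵥ p.1 + Lm *ᵥ p.2) a = 0 := fun a => by
        have := congrFun h (Sum.inl a); rwa [Sum.elim_inl] at this
      have r2 : ∀ a, (Lt *ᵥ p.1 + Dc *ᵥ p.2) a = 0 := fun a => by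
        have := congrFun h (Sum.inr a); rwa [Sum.elim_inr] at this
      have hE2 : ∀ a, bz (negNegOne (base.cls a)) * p.1 a + ∑ j, bz (base.neg a j) * (p.2 j + p.2 a) = 0 := fun a => by
        have := r1 a; rwa [hrow1] at this
      have hr := hrel p.1 p.2 hE2
      refine ⟨fun a => ?_, hE2⟩
      have e := r2 a
      rw [hrow2] at e
      linear_combination e - bz (negNegOne (base.cls a)) * hr
  have hmap : base.virtualKernel.map Ψ = LinearMap.ker S.mulVecLin := by
    apply le_antisymm
    · intro z hz
      obtain ⟨p, hp, rfl⟩ := Submodule.mem_map.1 hz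
      rw [hmem] at hp
      rw [LinearMap.mem_ker, mulVecLin_apply]
      exact hp
    · intro z hz
      rw [LinearMap.mem_ker, mulVecLin_apply] at hz
      have hz' : Ψ (z ∘ Sum.inl, z ∘ Sum.inr) = z := by
        rw [hΨ]
        funext i
        rcases i with a | a <;> simp
      refine Submodule.mem_map.2 ⟨(z ∘ Sum.inl, z ∘ Sum.inr), ?_, hz'⟩
      rw [hmem, hz']
      exact hz
  rw [LinearEquiv.finrank_eq (Submodule.equivMapOfInjective Ψ hΨinj base.virtualKernel), hmap]
  exact hpar

/-- ★ **Dimension of a legitimate augmented kernel.** If `(δ, 1) ∉ 𝒦` then `finrank 𝒦⁺(δ) = finrank 𝒦 + 1`. -/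
theorem finrank_augKernel_eq (δ : Fin (k + 1) → ZMod 2)
    (hδ : ((δ, fun _ => (1 : ZMod 2)) : (Fin (k + 1) → ZMod 2) × (Fin (k + 1) → ZMod 2)) ∉ base.virtualKernel) :
    finrank (ZMod 2) ↥(base.augKernel δ) = finrank (ZMod 2) ↥base.virtualKernel + 1 := by
  unfold SymbData.augKernel
  set w : (Fin (k + 1) → ZMod 2) × (Fin (k + 1) → ZMod 2) := (δ, fun _ => (1 : ZMod 2)) with hw
  have hw0 : w ≠ 0 := by
    intro h
    have h1 := congrFun (congrArg Prod.snd h) 0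
    simp [hw] at h1
  have hdis : base.virtualKernel ⊓ Submodule.span (ZMod 2) {w} = ⊥ :=
    disjoint_iff.1 ((Submodule.disjoint_span_singleton).2 fun h => absurd h hδ)
  have h := Submodule.finrank_sup_add_finrank_inf_eq base.virtualKernel (Submodule.span (ZMod 2) {w})
  rw [hdis, finrank_bot, add_zero, finrank_span_singleton hw0] at h
  exact h

/-- ★★ **THEOREM A (odd bases) without the dimension hypothesis.** For a root-number-`−1` odd base (`Σ_b ([P_b ≡ 3 (4)] + [(2/P_b) = −1]) = 1`
in `𝔽₂`) and a legitimate `δ` (`(δ,1) ∉ 𝒦`), put `τ := (finrank 𝒦 + 1)/2` (an integer by `odd_finrank_virtualKernel`, and `finrank 𝒦⁺(δ) = 2τ`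
automatically): if `𝒦⁺(δ)` meets `V × 0`, `0 × V` and the diagonal in dimension `≤ τ`, a pattern-free Heegner recipe with `τ + 1` auxiliary primes
exists (`exists_patternFree_design`, p742384, with `hdim` discharged by the kernel parity).
[cite: HeathBrown1994SelmerCongruentII, Appendix (Monsky), typescript pp. 39–41] -/
theorem exists_patternFree_design_of_odd (hroot : (∑ b, (bz (negNegOne (base.cls b)) + bz (negTwo (base.cls b)))) = 1)
    (δ : Fin (k + 1) → ZMod 2)
    (hδ : ((δ, fun _ => (1 : ZMod 2)) : (Fin (k + 1) → ZMod 2) × (Fin (k + 1) → ZMod 2)) ∉ base.virtualKernel)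
    (h1 : finrank (ZMod 2) ↥(base.augKernel δ ⊓
      LinearMap.ker (LinearMap.snd (ZMod 2) (Fin (k + 1) → ZMod 2) (Fin (k + 1) → ZMod 2))) ≤
        (finrank (ZMod 2) ↥base.virtualKernel + 1) / 2)
    (h2 : finrank (ZMod 2) ↥(base.augKernel δ ⊓
      LinearMap.ker (LinearMap.fst (ZMod 2) (Fin (k + 1) → ZMod 2) (Fin (k + 1) → ZMod 2))) ≤
        (finrank (ZMod 2) ↥base.virtualKernel + 1) / 2)
    (h3 : finrank (ZMod 2) ↥(base.augKernel δ ⊓ LinearMap.ker (LinearMap.fst (ZMod 2) (Fin (k + 1) → ZMod 2) (Fin (k + 1) → ZMod 2) +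
      LinearMap.snd (ZMod 2) (Fin (k + 1) → ZMod 2) (Fin (k + 1) → ZMod 2))) ≤
        (finrank (ZMod 2) ↥base.virtualKernel + 1) / 2) :
    ∃ (c₁ : AuxCell) (rest : List AuxCell), rest.length = (finrank (ZMod 2) ↥base.virtualKernel + 1) / 2 ∧
      heegnerK base (c₁ :: rest) = true ∧ ∀ pat : ℕ → ℕ → Bool, (dataK base (c₁ :: rest) pat).monskyOddS.det = 1 := by
  obtain ⟨r, hr⟩ := odd_finrank_virtualKernel base hroot
  have hτ : (finrank (ZMod 2) ↥base.virtualKernel + 1) / 2 = r + 1 := by omega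
  rw [hτ] at h1 h2 h3 ⊢
  have hdim : finrank (ZMod 2) ↥(base.augKernel δ) = 2 * (r + 1) := by
    rw [finrank_augKernel_eq base δ hδ, hr]; ring
  exact exists_patternFree_design base δ (r + 1) hδ hdim h1 h2 h3

end OddKernelParity

end Summit.BirchSwinnertonDyer.BirchSwinnertonDyer.Theorems.SymbolicMonsky
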